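import Literature.RingTheory.Smooth.AugmentationIdealCotangentBaseChange
import Mathlib.RingTheory.Localization.Away.Basic
import Mathlib.RingTheory.Localization.Ideal
import HarnessLib

/-!
# The conormal module `I/I²` of an augmentation does not see a localisation `S → S[1/h]`, `ε(h) = 1`

Topic `Literature/RingTheory/Smooth`, namespace `Literature.RingTheory.Smooth`.  Sequel of
`RingTheory/Smooth/AugmentationIdealCotangentBaseChange` (the augmentation ideal `I = ker ε` of an augmented `R`-algebra
`ε : S → R` and its conormal module `I/I²`).  THEOREMS and one `def` (a linear equivalence); no named fact (net debt 0).

THE PRINT.  Görtz–Wedhorn, *Algebraic Geometry II*, (17.3): for an immersion `i : Y → X`, written as a closed immersion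
`Y → U` into an open `U ⊆ X` with ideal `𝓘`, the conormal sheaf `𝒞_i = 𝓘/𝓘²` «does not depend on the choice of `U`»
(it is `𝒥/𝒥²` for the kernel `𝒥` of `i^♯ : i⁻¹𝒪_X → 𝒪_Y`), and Remark 17.14 (functoriality `w_{i',i}` along commutative
squares).  Here: `Y = Spec R`, `X ⊇ U = Spec S` with `i` the section `ε`, and the smaller open `U' = D(h) = Spec S[1/h]`
(`ε(h) = 1`, so the section lands in `D(h)`); the restriction `S → S' = S[1/h]` induces an ISOMORPHISM `I/I² ≅ I'/I'²` of
the two conormal modules (`I' = ker ε'`, `ε'` the augmentation of `S'` extending `ε`).  This is the algebra that lets an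
endomorphism of a pointed scheme which does NOT preserve an affine chart of the point still act on the chart's conormal
module (through `S → S[1/h] ← S`), as needed for the cotangent action of endomorphisms of an abelian scheme along the unit
section (cell `hodgecm-mathlib`, row II-2β, brick G3a).

WHAT IS PROVED (`ε : S →ₐ[R] R`, `ε' : S' →ₐ[R] R` with `ε' ∘ (S → S') = ε`, `[IsLocalization.Away h S']`, `ε h = 1`):
* `augIdeal_le_comap`' form `augIdeal_le_comap_algebraMap` (any `S → S'` compatible with the augmentations);
* `augIdeal_map_algebraMap` — `I' = I · S'`;
* `mapCotangent_algebraMap_surjective` / `_injective` / `_bijective` — the restriction `I/I² → I'/I'²` is bijective;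
* **`augCotangentLocalizationEquiv ε ε' hε h hh : (augIdeal ε).Cotangent ≃ₗ[R] (augIdeal ε').Cotangent`**, with
  `augCotangentLocalizationEquiv_toCotangent`.

## References
* [GortzWedhorn2023] U. Görtz, T. Wedhorn, *Algebraic Geometry II: Cohomology of Schemes* (2023), (17.3) (17.3.1) and the
  paragraph after it; Remark 17.14.
-/

noncomputable section

namespace Literature.RingTheory.Smooth

open TensorProduct

variable {R S S' : Type*} [CommRing R] [CommRing S] [CommRing S'] [Algebra R S] [Algebra R S'] [Algebra S S']
  [IsScalarTower R S S'] (ε : S →ₐ[R] R) (ε' : S' →ₐ[R] R) (hε : ∀ s : S, ε' (algebraMap S S' s) = ε s)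

/-! ### Any `S → S'` compatible with the augmentations maps `I` into `I'` -/

include hε in
/-- `I ≤ (S → S')⁻¹ I'` when `ε' ∘ (S → S') = ε` (Görtz–Wedhorn II, Remark 17.14: the square of the two sections commutes).
[cite: GortzWedhorn2023, Remark 17.14] -/
theorem augIdeal_le_comap_algebraMap :
    augIdeal ε ≤ (augIdeal ε').comap (IsScalarTower.toAlgHom R S S') := by
  intro s hs
  rw [Ideal.mem_comap, mem_augIdeal_iff, IsScalarTower.coe_toAlgHom', hε]
  exact (mem_augIdeal_iff ε s).1 hs

include hε in
omit [IsScalarTower R S S'] in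
/-- The image of `I` lies in `I'`. [cite: GortzWedhorn2023, Remark 17.14] -/
theorem algebraMap_mem_augIdeal {s : S} (hs : s ∈ augIdeal ε) : algebraMap S S' s ∈ augIdeal ε' := by
  rw [mem_augIdeal_iff, hε]
  exact (mem_augIdeal_iff ε s).1 hs

/-! ### Localising at `h` with `ε(h) = 1` -/

section Away

variable (h : S) (hh : ε h = 1) [IsLocalization.Away h S']

include hε hh in
omit [IsScalarTower R S S'] [IsLocalization.Away h S'] in
/-- `(S → S')(h ^ n) - 1 ∈ I'`: the section lands in `D(h)`. [cite: GortzWedhorn2023, (17.3)] -/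
theorem algebraMap_pow_sub_one_mem (n : ℕ) : algebraMap S S' (h ^ n) - 1 ∈ augIdeal ε' := by
  rw [mem_augIdeal_iff, map_sub, hε, map_pow, hh, one_pow, map_one, sub_self]

include hε in
omit [IsScalarTower R S S'] in
/-- Every element of `I'` is `(S → S')(s) · (S → S')(h ^ n)⁻¹` with `s ∈ I`: clearing the denominator of an element of the
augmentation ideal of `S[1/h]` gives an element of the augmentation ideal of `S`. [cite: GortzWedhorn2023, (17.3)] -/
theorem exists_mul_algebraMap_pow_eq (x : S') (hx : x ∈ augIdeal ε') :
    ∃ (s : S) (n : ℕ), s ∈ augIdeal ε ∧ x * algebraMap S S' (h ^ n) = algebraMap S S' s := by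
  obtain ⟨⟨s, ⟨m, hm⟩⟩, hsm⟩ := IsLocalization.surj (Submonoid.powers h) x
  obtain ⟨n, rfl⟩ := (Submonoid.mem_powers_iff _ _).1 hm
  refine ⟨s, n, ?_, hsm⟩
  rw [mem_augIdeal_iff, ← hε, ← hsm, map_mul, (mem_augIdeal_iff ε' x).1 hx, zero_mul]

include hε h in
/-- **`I' = I · S[1/h]`**: the augmentation ideal of the localisation is the extension of the augmentation ideal.
[cite: GortzWedhorn2023, (17.3) and Remark 17.15 (1)] -/
theorem augIdeal_map_algebraMap : (augIdeal ε).map (algebraMap S S') = augIdeal ε' := by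
  refine le_antisymm (Ideal.map_le_iff_le_comap.2 (augIdeal_le_comap_algebraMap ε ε' hε)) fun x hx => ?_
  obtain ⟨s, n, hs, hx'⟩ := exists_mul_algebraMap_pow_eq ε ε' hε h x hx
  have hu : IsUnit (algebraMap S S' (h ^ n)) :=
    IsLocalization.map_units S' (⟨h ^ n, n, rfl⟩ : Submonoid.powers h)
  have : x = algebraMap S S' s * ↑hu.unit⁻¹ := by
    rw [← hx', mul_assoc, IsUnit.mul_val_inv, mul_one]
  rw [this]
  exact Ideal.mul_mem_right _ _ (Ideal.mem_map_of_mem _ hs)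

include hε hh in
/-- **The restriction `I/I² → I'/I'²` is surjective**: the class of `x = s / h ^ n ∈ I'` is the class of `s ∈ I`, because
`x - s = x (1 - h ^ n) ∈ I' · I'`. [cite: GortzWedhorn2023, (17.3) (independence of `U`)] -/
theorem mapCotangent_algebraMap_surjective :
    Function.Surjective ((augIdeal ε).mapCotangent (augIdeal ε') (IsScalarTower.toAlgHom R S S')
      (augIdeal_le_comap_algebraMap ε ε' hε)) := by
  intro y
  obtain ⟨x, rfl⟩ := Ideal.toCotangent_surjective _ y
  obtain ⟨s, n, hs, hx⟩ := exists_mul_algebraMap_pow_eq ε ε' hε h x x.2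
  refine ⟨(augIdeal ε).toCotangent ⟨s, hs⟩, ?_⟩
  rw [Ideal.mapCotangent_toCotangent, Ideal.toCotangent_eq, pow_two]
  have key : (IsScalarTower.toAlgHom R S S' s : S') - x = x * (algebraMap S S' (h ^ n) - 1) := by
    rw [IsScalarTower.coe_toAlgHom', ← hx]; ring
  change (IsScalarTower.toAlgHom R S S' s : S') - x ∈ _
  rw [key]
  exact Ideal.mul_mem_mul x.2 (algebraMap_pow_sub_one_mem ε ε' hε h hh n)

include hε hh in
/-- **The restriction `I/I² → I'/I'²` is injective**: if `s ∈ I` becomes a member of `I'² = I² · S[1/h]`, then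
`h ^ N s ∈ I²` for some `N`, and `s = h ^ N s + (1 - h ^ N) s ∈ I²` since `1 - h ^ N ∈ I`.
[cite: GortzWedhorn2023, (17.3) (independence of `U`)] -/
theorem mapCotangent_algebraMap_injective :
    Function.Injective ((augIdeal ε).mapCotangent (augIdeal ε') (IsScalarTower.toAlgHom R S S')
      (augIdeal_le_comap_algebraMap ε ε' hε)) := by
  rw [injective_iff_map_eq_zero]
  intro y hy
  obtain ⟨s, rfl⟩ := Ideal.toCotangent_surjective _ y
  rw [Ideal.mapCotangent_toCotangent, Ideal.toCotangent_eq_zero, Subtype.coe_mk, IsScalarTower.coe_toAlgHom',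
    ← augIdeal_map_algebraMap ε ε' hε h, ← Ideal.map_pow,
    IsLocalization.mem_map_algebraMap_iff (Submonoid.powers h) S'] at hy
  obtain ⟨⟨⟨t, ht⟩, ⟨m, hm⟩⟩, htm⟩ := hy
  obtain ⟨n, rfl⟩ := (Submonoid.mem_powers_iff _ _).1 hm
  simp only [← map_mul] at htm
  obtain ⟨⟨c, hc⟩, hc'⟩ := (IsLocalization.eq_iff_exists (Submonoid.powers h) S').1 htm
  obtain ⟨k, rfl⟩ := (Submonoid.mem_powers_iff _ _).1 hc
  simp only at hc'
  -- `h ^ k * (s * h ^ n) ∈ I²`, hence `s * h ^ (n + k) ∈ I²`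
  have h1 : (s : S) * h ^ (n + k) ∈ augIdeal ε ^ 2 := by
    have : (s : S) * h ^ (n + k) = h ^ k * (s * h ^ n) := by ring
    rw [this, hc']
    exact Ideal.mul_mem_left _ _ ht
  have h2 : (s : S) * (1 - h ^ (n + k)) ∈ augIdeal ε ^ 2 := by
    rw [pow_two]
    refine Ideal.mul_mem_mul s.2 ?_
    rw [mem_augIdeal_iff, map_sub, map_one, map_pow, hh, one_pow, sub_self]
  rw [Ideal.toCotangent_eq_zero]
  have : (s : S) = s * h ^ (n + k) + s * (1 - h ^ (n + k)) := by ring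
  rw [this]
  exact add_mem h1 h2

include hε hh in
/-- **The restriction `I/I² → I'/I'²` is bijective.** [cite: GortzWedhorn2023, (17.3) (independence of `U`)] -/
theorem mapCotangent_algebraMap_bijective :
    Function.Bijective ((augIdeal ε).mapCotangent (augIdeal ε') (IsScalarTower.toAlgHom R S S')
      (augIdeal_le_comap_algebraMap ε ε' hε)) :=
  ⟨mapCotangent_algebraMap_injective ε ε' hε h hh, mapCotangent_algebraMap_surjective ε ε' hε h hh⟩

/-- **`I/I² ≅ I'/I'²` for `S' = S[1/h]`, `ε(h) = 1`**: the conormal module of the section does not change when the affine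
chart `Spec S` of the section is replaced by the basic open `D(h) ∋` (the section) (Görtz–Wedhorn II (17.3): the conormal
sheaf does not depend on the open `U`). [cite: GortzWedhorn2023, (17.3) (17.3.1) and the paragraph after it] -/
def augCotangentLocalizationEquiv : (augIdeal ε).Cotangent ≃ₗ[R] (augIdeal ε').Cotangent :=
  LinearEquiv.ofBijective _ (mapCotangent_algebraMap_bijective ε ε' hε h hh)

/-- The equivalence on classes: `[s] ↦ [s/1]`. [cite: GortzWedhorn2023, (17.3) and Remark 17.14] -/
theorem augCotangentLocalizationEquiv_toCotangent (s : augIdeal ε) :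
    augCotangentLocalizationEquiv ε ε' hε h hh ((augIdeal ε).toCotangent s) =
      (augIdeal ε').toCotangent ⟨algebraMap S S' s, algebraMap_mem_augIdeal ε ε' hε s.2⟩ := by
  rw [augCotangentLocalizationEquiv, LinearEquiv.ofBijective_apply, Ideal.mapCotangent_toCotangent]
  rfl

/-- The equivalence IS the restriction map `mapCotangent (S → S')` (as a linear map). [cite: GortzWedhorn2023, Remark 17.14] -/
theorem augCotangentLocalizationEquiv_toLinearMap :
    (augCotangentLocalizationEquiv ε ε' hε h hh : (augIdeal ε).Cotangent →ₗ[R] (augIdeal ε').Cotangent) =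
      (augIdeal ε).mapCotangent (augIdeal ε') (IsScalarTower.toAlgHom R S S')
        (augIdeal_le_comap_algebraMap ε ε' hε) :=
  rfl

end Away

end Literature.RingTheory.Smooth

end
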